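import Mathlib.Tactic.Group
import Summits.MatrixMultiplication.MatrixMultiplication.Theses.GelfandPairHosts
import Summits.MatrixMultiplication.MatrixMultiplication.Theorems.GelfandHosting.Negative.CommutingAction
import Summits.MatrixMultiplication.MatrixMultiplication.Theorems.GelfandPairHostsGelfandHostingStubDesignOfSaturatedTriple

/-!
# `GelfandHosting` (crux stmt-MatrixMultiplication-7381), line `birth`: the `G`-automorphisms of a
# generously transitive host as a commuting action — `abc · |N_G(H)|² ≤ N³ · |H|²`

Negative-side support file of the line lead (2026-08-17); `sorry`-free, no new global definitions or
instances (the action of `N_G(H)/H` on `X` is built locally inside the proof).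

For a transitive `G`-set `X` with point stabiliser `H = G_{x₀}`, the group `Q = N_G(H)/H` acts on `X`
by `nH · (g • x₀) = (g n⁻¹) • x₀`, freely and commuting with `G` (it is the automorphism group of the
`G`-set; its orbit through `x₀` is `Fix_X(H)`, so `|Q| = |Fix_X(H)| = |N_G(H)|/|H|`).  When the action is
GENEROUSLY transitive — the hypothesis of `stub_saturatedTripleHosts` — `Q` has exponent `2`
(`sq_mem_stabilizer_of_mem_normalizer`) hence is abelian, and `commutingAction_design_capacity` applies
with `q = N/|Q|` orbits: every (general) module-TPP design satisfies `abc ≤ (N/|Q|)²·N`, i.e.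

  `abc · |N_G(H)|² ≤ N³ · |H|²`   (`generouslyTransitive_design_capacity`).

So a witness of the stub (or of the crux in a generously transitive host) needs
`|Fix_X(H)| = |N_G(H)/H| ≤ N^{3/4+o(1)}`; the transvection / wreath hosts `A ≀ C₂` have `|Fix_X(H)| = N/2`
and get `abc ≤ 4N` for ALL designs.
-/

-- the tree's namespace `Summit.MatrixMultiplication.MatrixMultiplication.…` repeats a component by design
set_option linter.dupNamespace false

namespace Summit.MatrixMultiplication.MatrixMultiplication.Theorems.GelfandHosting.Negative

/-- Well-definedness of the automorphism action: if `g • x₀ = g' • x₀` and `n, n'` lie in the normaliser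
of the stabiliser `H` of `x₀` with `n⁻¹ n' ∈ H`, then `(g n⁻¹) • x₀ = (g' n'⁻¹) • x₀`. [folklore] -/
theorem autAction_wd {G X : Type*} [Group G] [MulAction G X] (x₀ : X) (g g' n n' : G)
    (hn : n ∈ Subgroup.normalizer (MulAction.stabilizer G x₀ : Set G))
    (hgg : g • x₀ = g' • x₀) (hnn : n⁻¹ * n' ∈ MulAction.stabilizer G x₀) :
    (g * n⁻¹) • x₀ = (g' * n'⁻¹) • x₀ := by
  have h0 : g⁻¹ * g' ∈ MulAction.stabilizer G x₀ := by
    rw [MulAction.mem_stabilizer_iff, mul_smul, ← hgg, inv_smul_smul]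
  -- `m := n (g⁻¹ g') (n'⁻¹ n) n⁻¹ ∈ H`
  have h1 : (g⁻¹ * g') * (n⁻¹ * n')⁻¹ ∈ MulAction.stabilizer G x₀ :=
    Subgroup.mul_mem _ h0 (Subgroup.inv_mem _ hnn)
  have h2 : n * ((g⁻¹ * g') * (n⁻¹ * n')⁻¹) * n⁻¹ ∈ MulAction.stabilizer G x₀ :=
    (Subgroup.mem_normalizer_iff.mp hn _).mp h1
  have e : g' * n'⁻¹ = (g * n⁻¹) * (n * ((g⁻¹ * g') * (n⁻¹ * n')⁻¹) * n⁻¹) := by group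
  rw [e, mul_smul (g * n⁻¹), MulAction.mem_stabilizer_iff.mp h2]

/-- **Capacity of generously transitive hosts through their automorphism group.**  Let `G ↷ X` be
generously transitive (every pair of points is swapped by a group element), `x₀ ∈ X`, `H = G_{x₀}`,
`N_G(H)` its normaliser.  Every module-TPP design `(φ, ψ, χ)` of size `(a,b,c)` in `X` satisfies
`a·b·c·|N_G(H)|² ≤ |X|³·|H|²`, i.e. `abc ≤ N·(N/|Fix_X(H)|)²` since `|N_G(H)|/|H| = |Fix_X(H)|`.
Proof: `Q = N_G(H)/H` acts on `X` by `nH · (g • x₀) = (g n⁻¹) • x₀`, freely and commuting with `G`;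
generous transitivity makes `Q` of exponent two, hence abelian (`sq_mem_stabilizer_of_mem_normalizer`);
apply `commutingAction_design_capacity` to this action (`q = N/|Q|` orbits). [folklore] -/
theorem generouslyTransitive_design_capacity {G X : Type} [Group G] [Fintype G] [MulAction G X]
    [Fintype X] [DecidableEq X] (hgt : ∀ x y : X, ∃ g : G, g • x = y ∧ g • y = x) (x₀ : X)
    {a b c : ℕ} (φ : Fin a × Fin b → G) (ψ : Fin b × Fin c → X) (χ : Fin a × Fin c → X)
    (hdes : ∀ (i i' : Fin a) (j j' : Fin b) (k k' : Fin c),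
      φ (i, j) • ψ (j', k) = χ (i', k') ↔ (i = i' ∧ j = j' ∧ k = k')) :
    a * b * c * Nat.card (Subgroup.normalizer ((MulAction.stabilizer G x₀ : Subgroup G) : Set G)) ^ 2 ≤
      Fintype.card X ^ 3 * Nat.card (MulAction.stabilizer G x₀) ^ 2 := by
  classical
  let Nn : Subgroup G := Subgroup.normalizer ((MulAction.stabilizer G x₀ : Subgroup G) : Set G)
  have hHN : MulAction.stabilizer G x₀ ≤ Nn := (MulAction.stabilizer G x₀).le_normalizer
  let K : Subgroup Nn := (MulAction.stabilizer G x₀).subgroupOf Nn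
  haveI hK : K.Normal := Subgroup.normal_in_normalizer
  have memK : ∀ m : Nn, m ∈ K ↔ ((m : G)) • x₀ = x₀ := fun m => by
    rw [Subgroup.mem_subgroupOf, MulAction.mem_stabilizer_iff]
  -- transporters `tr x • x₀ = x`
  have htrans : ∀ x : X, ∃ g : G, g • x₀ = x := fun x => (hgt x₀ x).imp fun g hg => hg.1
  choose tr htr using htrans
  -- the action map of `Q = Nn ⧸ K` on `X`
  have wd : ∀ (x : X) (n n' : Nn), n⁻¹ * n' ∈ K →
      (tr x * ((n : G))⁻¹) • x₀ = (tr x * ((n' : G))⁻¹) • x₀ := by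
    intro x n n' hnn
    refine autAction_wd x₀ (tr x) (tr x) n n' n.2 rfl ?_
    rw [MulAction.mem_stabilizer_iff]
    simpa only [Subgroup.coe_mul, Subgroup.coe_inv] using (memK _).mp hnn
  let ρ : Nn ⧸ K → X → X := fun q x =>
    Quotient.liftOn' q (fun n : Nn => (tr x * ((n : G))⁻¹) • x₀)
      (fun n n' hnn => wd x n n' (by rwa [QuotientGroup.leftRel_apply] at hnn))
  have ρ_mk : ∀ (n : Nn) (x : X), ρ (n : Nn ⧸ K) x = (tr x * ((n : G))⁻¹) • x₀ := fun n x => rfl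
  -- `ρ` computed with any transporter
  have ρ_eq : ∀ (n : Nn) (x : X) (g : G), g • x₀ = x →
      ρ (n : Nn ⧸ K) x = (g * ((n : G))⁻¹) • x₀ := by
    intro n x g hg
    rw [ρ_mk]
    exact autAction_wd x₀ (tr x) g n n n.2 (by rw [htr, hg]) (by simp)
  -- the local action instance
  letI : MulAction (Nn ⧸ K) X :=
    { smul := ρ
      one_smul := fun x => by
        show ρ ((1 : Nn) : Nn ⧸ K) x = x
        rw [ρ_mk]; simp [htr]
      mul_smul := fun q q' x => by
        show ρ (q * q') x = ρ q (ρ q' x)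
        induction q using QuotientGroup.induction_on with
        | H n =>
          induction q' using QuotientGroup.induction_on with
          | H n' =>
            rw [← QuotientGroup.mk_mul, ρ_mk,
              ρ_eq n (ρ (n' : Nn ⧸ K) x) (tr x * ((n' : G))⁻¹) (ρ_mk n' x).symm]
            congr 1
            simp only [Subgroup.coe_mul, mul_inv_rev, mul_assoc] }
  have smul_def : ∀ (q : Nn ⧸ K) (x : X), q • x = ρ q x := fun _ _ => rfl
  -- commutation with `G`
  have hcomm : ∀ (g : G) (q : Nn ⧸ K) (x : X), g • (q • x) = q • (g • x) := by
    intro g q x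
    induction q using QuotientGroup.induction_on with
    | H n =>
      rw [smul_def, smul_def, ρ_mk, ρ_eq n (g • x) (g * tr x) (by rw [mul_smul, htr]), ← mul_smul,
        mul_assoc]
  -- freeness
  have hfree : ∀ (q : Nn ⧸ K) (x : X), q • x = x → q = 1 := by
    intro q x
    induction q using QuotientGroup.induction_on with
    | H n =>
      intro h
      rw [smul_def, ρ_mk] at h
      -- `(tr x n⁻¹) • x₀ = tr x • x₀` gives `n⁻¹ ∈ H`, hence `n ∈ K`
      have e0 : (tr x)⁻¹ • x = x₀ := by rw [inv_smul_eq_iff, htr]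
      have h1 : ((n : G))⁻¹ • x₀ = x₀ := by
        have := congrArg (fun y => (tr x)⁻¹ • y) h
        simp only [← mul_smul, inv_mul_cancel_left] at this
        rw [e0] at this
        exact this
      have h2 : ((n : G)) • x₀ = x₀ := by
        conv_lhs => rw [← h1]
        rw [smul_inv_smul]
      rw [eq_comm, ← QuotientGroup.mk_one, QuotientGroup.eq, inv_one, one_mul]
      exact (memK n).mpr h2
  -- exponent two, hence commutative
  have hsq : ∀ q : Nn ⧸ K, q * q = 1 := by
    intro q
    induction q using QuotientGroup.induction_on with
    | H n =>
      rw [← QuotientGroup.mk_mul, ← QuotientGroup.mk_one, QuotientGroup.eq, mul_one,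
        Subgroup.inv_mem_iff]
      refine (memK _).mpr ?_
      rw [Subgroup.coe_mul]
      exact MulAction.mem_stabilizer_iff.mp
        (sq_mem_stabilizer_of_mem_normalizer hgt x₀ (n : G) n.2)
  have hinv : ∀ q : Nn ⧸ K, q⁻¹ = q := fun q => inv_eq_of_mul_eq_one_right (hsq q)
  have hcommQ : ∀ q q' : Nn ⧸ K, q * q' = q' * q := by
    intro q q'
    calc q * q' = (q * q')⁻¹ := (hinv _).symm
      _ = q'⁻¹ * q⁻¹ := mul_inv_rev _ _
      _ = q' * q := by rw [hinv, hinv]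
  letI : CommGroup (Nn ⧸ K) := { (inferInstance : Group (Nn ⧸ K)) with mul_comm := hcommQ }
  -- orbit presentation of the commuting action (additive form)
  let Ω := Quotient (MulAction.orbitRel (Nn ⧸ K) X)
  haveI : Fintype Ω := Fintype.ofFinite Ω
  let base : Ω → X := Quotient.out
  have hout : ∀ x : X, ∃ q : Nn ⧸ K, q • base (Quotient.mk _ x) = x := by
    intro x
    have hx : base (Quotient.mk _ x) ∈ MulAction.orbit (Nn ⧸ K) x :=
      MulAction.orbitRel_apply.mp (Quotient.mk_out x)
    obtain ⟨q, hq⟩ := hx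
    exact ⟨q⁻¹, by rw [← hq]; simp [smul_smul]⟩
  choose κq hκq using hout
  have key := commutingAction_design_capacity (G := G) (C := Additive (Nn ⧸ K))
    (fun x : X => (Quotient.mk (MulAction.orbitRel (Nn ⧸ K) X) x : Ω)) base
    (fun x => Additive.ofMul (κq x)) (fun x => hκq x)
    (fun g c x => hcomm g (Additive.toMul c) x) φ ψ χ hdes
  -- `|X| = |Ω| · |Q|` (free action) and `|Q| · |H| = |N_G(H)|`
  have hstab : ∀ x : X, MulAction.stabilizer (Nn ⧸ K) x = ⊥ := by
    intro x
    rw [Subgroup.eq_bot_iff_forall]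
    intro q hq
    exact hfree q x hq
  have hcardX : Nat.card X = Nat.card Ω * Nat.card (Nn ⧸ K) := by
    rw [Nat.card_congr (MulAction.selfEquivSigmaOrbitsQuotientStabilizer (Nn ⧸ K) X), Nat.card_sigma]
    simp_rw [hstab]
    rw [Finset.sum_const, Finset.card_univ, smul_eq_mul, ← Nat.card_eq_fintype_card,
      Nat.card_congr (QuotientGroup.quotientBot (G := Nn ⧸ K)).toEquiv]
  have hcardN : Nat.card Nn = Nat.card (Nn ⧸ K) * Nat.card (MulAction.stabilizer G x₀) := by
    rw [Subgroup.card_eq_card_quotient_mul_card_subgroup K,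
      Nat.card_congr (Subgroup.subgroupOfEquivOfLe hHN).toEquiv]
  -- assemble
  have hX : Fintype.card X = Fintype.card Ω * Nat.card (Nn ⧸ K) := by
    rw [← Nat.card_eq_fintype_card, ← Nat.card_eq_fintype_card]; exact hcardX
  have hk : a * b * c ≤ Fintype.card Ω ^ 2 * (Fintype.card Ω * Nat.card (Nn ⧸ K)) := by
    rw [← hX]; exact key
  show a * b * c * Nat.card Nn ^ 2 ≤ Fintype.card X ^ 3 * Nat.card (MulAction.stabilizer G x₀) ^ 2
  rw [hcardN, hX]
  calc a * b * c * (Nat.card (Nn ⧸ K) * Nat.card (MulAction.stabilizer G x₀)) ^ 2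
      ≤ Fintype.card Ω ^ 2 * (Fintype.card Ω * Nat.card (Nn ⧸ K)) *
          (Nat.card (Nn ⧸ K) * Nat.card (MulAction.stabilizer G x₀)) ^ 2 := Nat.mul_le_mul_right _ hk
    _ = (Fintype.card Ω * Nat.card (Nn ⧸ K)) ^ 3 * Nat.card (MulAction.stabilizer G x₀) ^ 2 := by ring

/-- **Stub-3 form.** In the exact setting of `stub_saturatedTripleHosts` — a generously transitive
host `G ↷ X`, a base point `x₀` with stabiliser `H`, and a TPP triple `(S,T,U)` of `G` with
`U · H = U` — the capacity obeys `|S|·|T|·|U • x₀| · |N_G(H)|² ≤ |X|³ · |H|²`, i.e.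
`|S||T||U•x₀| ≤ N · (N/|Fix_X(H)|)²` (via the landed `stub_designOfSaturatedTriple` and
`generouslyTransitive_design_capacity`). [folklore] -/
theorem generouslyTransitive_saturatedTriple_capacity {G X : Type} [Group G] [Fintype G]
    [MulAction G X] [Fintype X] [DecidableEq X]
    (hgt : ∀ x y : X, ∃ g : G, g • x = y ∧ g • y = x) (x₀ : X) (S T U : Finset G)
    (htpp : ∀ s ∈ S, ∀ s' ∈ S, ∀ t ∈ T, ∀ t' ∈ T, ∀ u ∈ U, ∀ u' ∈ U,
      s * s'⁻¹ * (t * t'⁻¹) * (u * u'⁻¹) = 1 → s = s' ∧ t = t' ∧ u = u')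
    (hsat : ∀ u ∈ U, ∀ h : G, h • x₀ = x₀ → u * h ∈ U) :
    S.card * T.card * (U.image fun u => u • x₀).card *
        Nat.card (Subgroup.normalizer ((MulAction.stabilizer G x₀ : Subgroup G) : Set G)) ^ 2 ≤
      Fintype.card X ^ 3 * Nat.card (MulAction.stabilizer G x₀) ^ 2 := by
  obtain ⟨φ, ψ, χ, hdes⟩ :=
    Summit.MatrixMultiplication.MatrixMultiplication.Theorems.stub_designOfSaturatedTriple
      G X x₀ S T U htpp hsat
  exact generouslyTransitive_design_capacity hgt x₀ φ ψ χ hdes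

end Summit.MatrixMultiplication.MatrixMultiplication.Theorems.GelfandHosting.Negative
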